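import Mathlib
import Summits.NavierStokesRegularity.NavierStokesRegularity.Theorems.LerayQuarterDissipationFiniteDissipationLiouvilleThresholdKBudget
import Summits.NavierStokesRegularity.NavierStokesRegularity.Theorems.LerayQuarterDissipationFiniteDissipationLiouvilleSmallDissipationGap
import HarnessLib

/-!
# The dissipation threshold of the finite-dissipation stratum, file 3: in `𝒟_{C,K}` with
  `θ(K)⁴ ≤ 64/27` the Hölder defect is small somewhere (route `LerayQuarterDissipation`, crux
  `FiniteDissipationLiouville` stmt-NavierStokesRegularity-22144; lead prover g14, helper —
  `K`-direction analogue of `…ThresholdBudget.exists_slack_lt`)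

HONEST FRAMING. Analysis helper about a HYPOTHETICAL object (a Type-I ancient mild field in the KNSS
gauge with the quarter-rate dissipation law). Nothing here bears on Navier–Stokes regularity or
blow-up; no summit is proved.

CONTENTS. `exists_hoelderDefect_lt`: for `V ∈ 𝒟_{C,K}` with `θ(K) = √(max K 0)(√K_S)³`,
`θ(K)⁴ ≤ 64/27`: there are `L, M ≥ 0` such that for every `R ≥ 1` and `ε > 0` some similarity time
`s` has Hölder defect `H_R(s) < 2LM/R + ε` (`H_R(s) = 2√(max K 0)((‖g‖₂‖g‖₆³)^{1/2} − ‖g‖₄²)`,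
`g = φ_R Ω(s)`). Proof: scale invariance gives `∫‖DU(s)‖² ≤ max K 0` and `∫‖Ω(s)‖² ≤ M` for every
`s` (`…SmallDissipationGap`); the budget of file 2 then reads `Z_R' ≤ 2LM/R − H_R`; if the defect were
`≥ 2LM/R + ε` at all times, `Z_R ≥ 0` would decrease at rate `ε` forever. [folklore energy method]
-/

noncomputable section

set_option linter.dupNamespace false

namespace Summit.NavierStokesRegularity.NavierStokesRegularity.Theorems.FiniteDissipationLiouville.ThresholdK

open MeasureTheory Set Filter Topology Metric InnerProductSpace Function Real
open scoped RealInnerProductSpace ContDiff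
open Literature.Analysis Literature.Analysis.FluidPDE
open Summit.NavierStokesRegularity.NavierStokesRegularity.Theorems
open Summit.NavierStokesRegularity.NavierStokesRegularity.Theorems.GaussianGap
open Summit.NavierStokesRegularity.NavierStokesRegularity.Theorems.SimilarityEnstrophy
open Summit.NavierStokesRegularity.NavierStokesRegularity.Theorems.SmallDissipationGap

variable {C : ℝ} {V : ℝ → (EuclideanSpace ℝ (Fin 3)) → (EuclideanSpace ℝ (Fin 3))}

/-- **In `𝒟_{C,K}` at or below the dissipation threshold the Hölder defect is somewhere small.** For
a KNSS-gauge Type-I field with the dissipation law `∫‖DV(t)‖² ≤ K/√(−t)` and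
`(√(max K 0)(√K_S)³)⁴ ≤ 64/27` there are `L, M ≥ 0` such that for every cutoff radius `R ≥ 1` and
every `ε > 0` some similarity time `s` has
`2√(max K 0)((‖φ_RΩ(s)‖₂‖φ_RΩ(s)‖₆³)^{1/2} − ‖φ_RΩ(s)‖₄²) < 2LM/R + ε`.
(`Z_R ≤ ∫‖Ω‖² ≤ M`, `∫_{B̄_{2R}}‖Ω‖² ≤ M`, so the budget of `deriv_sqCutoffEnstrophy_add_hoelderDefect_le`
reads `Z_R' ≤ 2LM/R − H_R`; a non-negative quantity cannot decrease at a fixed rate forever.)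
[folklore energy method] -/
theorem exists_hoelderDefect_lt (hV : IsTypeIAncientMild C V) {K : ℝ}
    (hlaw : ∀ t : ℝ, t < 0 → ∫⁻ x, ‖fderiv ℝ (V t) x‖ₑ ^ 2 ≤ ENNReal.ofReal (K / Real.sqrt (-t)))
    (hθ : (Real.sqrt (max K 0) *
      Real.sqrt (SNormLESNormFDerivOfEqConst (EuclideanSpace ℝ (Fin 3))
        (volume : Measure (EuclideanSpace ℝ (Fin 3))) 2 : ℝ) ^ 3) ^ 4 ≤ 64 / 27) :
    ∃ L M : ℝ, 0 ≤ L ∧ 0 ≤ M ∧ ∀ R : ℝ, 1 ≤ R → ∀ ε : ℝ, 0 < ε → ∃ s : ℝ,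
      2 * Real.sqrt (max K 0) *
          (Real.sqrt (Real.sqrt (∫ y, ‖smoothTransition (2 - ‖y‖ ^ 2 / R ^ 2) • lerayVorticity V s y‖ ^ 2) *
              Real.sqrt (∫ y, ‖smoothTransition (2 - ‖y‖ ^ 2 / R ^ 2) • lerayVorticity V s y‖ ^ 6)) -
            Real.sqrt (∫ y, ‖smoothTransition (2 - ‖y‖ ^ 2 / R ^ 2) • lerayVorticity V s y‖ ^ 4)) <
        2 * L * M / R + ε := by
  have hDU := fun s => integrable_sq_norm_fderiv_lerayOrbit hV hlaw s
  obtain ⟨L, hL0, hbudget⟩ := deriv_sqCutoffEnstrophy_add_hoelderDefect_le hV (KU := max K 0)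
    (fun s => (hDU s).1) (fun s => (hDU s).2) hθ
  -- the law in similarity variables: `∫‖Ω(s)‖² ≤ M`
  obtain ⟨M, hM0, hM⟩ : ∃ M : ℝ, 0 ≤ M ∧ ∀ s : ℝ,
      Integrable (fun y => ‖lerayVorticity V s y‖ ^ 2) ∧ ∫ y, ‖lerayVorticity V s y‖ ^ 2 ≤ M := by
    refine ⟨_, ?_, fun s => integrable_sq_norm_lerayVorticity hV hlaw s⟩
    have h := (integrable_sq_norm_lerayVorticity hV hlaw 0).2
    exact (integral_nonneg fun y => sq_nonneg _).trans h
  refine ⟨L, M, hL0, hM0, fun R hR1 ε hε => ?_⟩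
  have hR : 0 < R := lt_of_lt_of_le one_pos hR1
  by_contra hcon
  push Not at hcon
  -- the squared-cutoff enstrophy and its derivative bound `≤ −ε`
  set Z : ℝ → ℝ := fun σ =>
    ∫ y, smoothTransition (2 - ‖y‖ ^ 2 / R ^ 2) ^ 2 * ‖lerayVorticity V σ y‖ ^ 2 with hZdef
  have hZd : ∀ s, DifferentiableAt ℝ Z s := fun s =>
    (hasDerivAt_sqCutoffEnstrophy hV hR s).differentiableAt
  have hZ0 : ∀ s, 0 ≤ Z s := fun s =>
    integral_nonneg fun y => mul_nonneg (sq_nonneg _) (sq_nonneg _)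
  have hZM : ∀ s, Z s ≤ M := by
    intro σ
    calc Z σ ≤ ∫ y, ‖lerayVorticity V σ y‖ ^ 2 := by
          refine integral_mono_of_nonneg (Eventually.of_forall fun y =>
            mul_nonneg (sq_nonneg _) (sq_nonneg _)) (hM σ).1 (Eventually.of_forall fun y => ?_)
          have h1 := sqCutoff_le_one R y
          have h0 : 0 ≤ ‖lerayVorticity V σ y‖ ^ 2 := sq_nonneg _
          have h2 : 0 ≤ smoothTransition (2 - ‖y‖ ^ 2 / R ^ 2) ^ 2 := sq_nonneg _
          show smoothTransition (2 - ‖y‖ ^ 2 / R ^ 2) ^ 2 * ‖lerayVorticity V σ y‖ ^ 2 ≤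
            ‖lerayVorticity V σ y‖ ^ 2
          nlinarith
      _ ≤ M := (hM σ).2
  have hI : ∀ s, (∫ y in closedBall (0 : EuclideanSpace ℝ (Fin 3)) (2 * R), ‖lerayVorticity V s y‖ ^ 2)
      ≤ M := fun s =>
    (setIntegral_le_integral (hM s).1 (Eventually.of_forall fun y => sq_nonneg _)).trans (hM s).2
  have hZ' : ∀ s, deriv Z s ≤ -ε := by
    intro s
    have hb := hbudget R hR1 s
    have hdef := hcon s
    have h1 : L / R * ((∫ y, smoothTransition (2 - ‖y‖ ^ 2 / R ^ 2) ^ 2 * ‖lerayVorticity V s y‖ ^ 2) +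
        ∫ y in closedBall (0 : EuclideanSpace ℝ (Fin 3)) (2 * R), ‖lerayVorticity V s y‖ ^ 2) ≤
        L / R * (M + M) :=
      mul_le_mul_of_nonneg_left (add_le_add (hZM s) (hI s)) (div_nonneg hL0 hR.le)
    have e : L / R * (M + M) = 2 * L * M / R := by ring
    show deriv Z s ≤ -ε
    simp only [hZdef]
    linarith
  -- `Z` decreases at rate `ε` forever: contradiction with `Z ≥ 0`
  have hdiff : Differentiable ℝ Z := hZd
  set s₁ : ℝ := Z 0 / ε + 1 with hs₁
  have hs₁pos : 0 < s₁ := by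
    have : 0 ≤ Z 0 / ε := div_nonneg (hZ0 0) hε.le
    linarith
  have hmvt : Z s₁ - Z 0 ≤ -ε * (s₁ - 0) :=
    image_sub_le_mul_sub_of_deriv_le hdiff hZ' hs₁pos.le
  have hneg : Z s₁ < 0 := by
    have e : -ε * (s₁ - 0) = -(Z 0) - ε := by
      rw [hs₁]; field_simp; ring
    rw [e] at hmvt
    linarith
  exact absurd (hZ0 s₁) (not_le.2 hneg)

end Summit.NavierStokesRegularity.NavierStokesRegularity.Theorems.FiniteDissipationLiouville.ThresholdK

end
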